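import Literature.IUT.HodgeArakelov.BadPrimeGaussianMonoidsUniqueFactorisationProofs
import Literature.IUT.HodgeArakelov.CohomologyLimitKummerComap
import Literature.IUT.HodgeArakelov.ThetaEnvDataRecordModel

/-!
# [IUTchII] Cor 3.5 (ii) "⥲" AT THE GENUINE RECORD `EtaleLevels.thetaEnvRecordKummer`: the restriction ISOMORPHISM
# `Ψ^ι_env(𝕄_*) ⥲ Ψ_ξ(𝕄_*)` with the junction hypotheses (R) «restriction of constants» and `hq₀` «unique factorisation»
# DERIVED — residual = Kummer injectivity (K), the orbit input `horb`, and the theta EVALUATION (E) (proof-only)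

S. Mochizuki, *Inter-universal Teichmüller theory II*, kurims Dec-2020 manuscript, Cor 3.5 (ii) p. 95 ("`Ψ^ι_env(M^Θ_*) ⥲
Ψ_ξ(M^Θ_*)` … isomorphisms of monoids"), Cor 3.5 (i) p. 94 ("by restricting the monoid `Ψ_cns(M^Θ_*)` … via `Π_{v▶} ↠
G_v`"), Prop 3.1 (ii) p. 88 (`Ψ_cns := M_TM`), Cor 2.8 (i) p. 82 (the restricted classes are the Kummer classes of the
theta VALUES), Rmk 2.5.1 (i) p. 72 (the theta value `q_v^{j²}`, a non-unit for `j ≠ 0`) [cite: Mochizuki2012, Cor 3.5 (ii) p.95]. Claim key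
DISPUTED (D-0012). PROOF-ONLY companion (abc-iut cell, layer L6, seat abc-iut-w4-d004 gen 3; node **IUTchII:Cor3.5(ii)**,
restriction-ISO clause, sub-DAG rows Cor-35.ii.r12 / Cor-35.iii.r14). NO definition, NO `Prop` fact, NO instance.

THE INSTANCE: `E := EtaleLevels.thetaEnvRecordKummer … c hA hfi O ι₀` (abc-iut-w4-d019, `ThetaEnvDataRecordModel.lean`) —
ambient module the genuine limit `lim_J H¹(Π^tp_{Ÿ̲̲} ∩ J, l·Δ_Θ)`, `Ψ_cns :=` abc-iut-w4-d007's `h1LimKummerOn c hA hfi O`.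
Label-wise evaluation SECTIONS `s_t : G_v → Π^tp_{X̲̲}` (continuous, into `Π^tp_{Ÿ̲̲}`, common coefficient action `φ₀`;
Cor 2.4 (ii)(c)) and restrictions `R_t` pinned to `h1LimCongr ∘ s_t^*` — exactly the data of abc-iut-w4-d004's Galois-clause
file `…GenuineRecordGaloisProofs.lean` (p425081) — plus `G_v`'s own action on the constants module `A` agreeing with the
action through every section (`hact`, Rmk 3.5.2 (iii)) and a `G_v`-level coefficient datum `c₀` with `c₀.hom = c.hom`.
* `hRκ_thetaEnvRecordKummer` — **(R) at the genuine record**: `R_t (κ m) = κ₀ m` for every constant `m ∈ O`, with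
  `κ₀ := h1LimKummerOn` over `G_v` (abc-iut-w4-d004 `restriction_kummerOn_eq_labelwise'`, `CohomologyLimitKummerComap.lean`;
  the identification `ψ` tautological, `hψκ` by `rfl`).
* **`exists_unique_restrictionIso'_thetaEnvRecordKummer`** — the UNIQUE isomorphism `Ψ^{ι₀}_env(𝕄_*) ⥲ Ψ_ξ ⊆ ∏_t κ₀(O)`
  pinned to the restrictions, for `θ ∈ θ^{ι₀}_env(𝕄_*)`: abc-iut-w4-d004's
  `exists_unique_restrictionIso'_ofKummer_gen_of_not_isUnit` (p429058) with (R) DERIVED and `hq₀` replaced by «`q_{t₀}` is not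
  a unit of `O`» (the constants module `A` being a group, `O ≤ A` is cancellative). RESIDUAL INPUTS, all named in print:
  (K) injectivity of the two Kummer maps `κ` (over `Π^tp_{Ÿ̲̲}`: abc-iut-w4-d007 `h1LimKummer_injective_mlf` /
  `h1LimKummer_injective_of_coeff` at `A = ℚ̄_pˣ`) and `κ₀` (over `G_v`: Kummer theory of the MLF), `horb` (`θ^{ι₀}_env` one
  `M^×_TM`-orbit — abc-iut-w4-d004 `horb_toRecord` at the produced record), and **(E) `hRθ : R_t θ = κ₀ (q_t)`, the theta
  EVALUATION of Cor 2.8 (i) / [EtTh] Prop 1.4 (iii)** with `q_{t₀}` a non-unit — THE load-bearing residual of the node.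
Nothing here asserts a disputed claim or takes a side on [IUTchIII] Cor 3.12; typed ≠ proved ≠ endorsed.
-/

noncomputable section

namespace Literature.IUT.HodgeArakelov

namespace EtaleLevels

open Literature.AnabelianGeometry.EtaleTheta CohomologySystemOfContH1 EtaleThetaDataOfSetting TemperedThetaMonoids
  BadPrimeGaussianMonoids

variable {p : ℕ} [Fact p.Prime] {D : Literature.AnabelianGeometry.EtaleTheta.ThetaSetting p}
  {E : D.EtaleThetaData} {l : ℕ} (C : E.DoubleUnderline l) (hC : D.Compat) (hS : D.Sec2Hyps)
  (hl : l.Prime) (hp2 : p ≠ 2) (hpl : p ≠ l) (hζ : ∃ ζ : D.K, IsPrimitiveRoot ζ (4 * l))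
  (mods : ∀ M : ℕ+, D.CyclotomeMod l M)
  (f : contCocycles D.toTheta D.DeltaTheta C.GtpYdduu) (hf : f ∈ C.rootCocycles hC)
  (hmods : ∀ (M M' : ℕ+) (h : (M : ℕ) ∣ (M' : ℕ)) (x : D.lDeltaTheta l),
    MuN.red p M M' h ((mods M').red x) = (mods M).red x)
  (h15 : Literature.AnabelianGeometry.EtaleTheta.ThetaSetting.Prop15iii E hC) (L : C.CuspLabels)
  (hZ : ∀ M : ℕ+, Nonempty (ModelCyclotomes.lDeltaQuot (C.rigidData (mods M) hC hS h15 L) ≃*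
    Literature.IUT.HodgeTheaters.ZHat))
  (hcharY : EtaleThetaDataOfSetting.PiYddCharacteristic C)
  (hlim : Function.Bijective (rigidLimHom C hC hS hl hp2 hpl hζ mods f hf hmods h15 L hZ))
  [(EtaleThetaDataOfSetting.PiYdd C).Normal]
  {A : Type} [CommGroup A] [MulDistribMulAction (Pi C) A] [TopologicalSpace A] [RootableBy A ℕ]
  (c : CyclotomeCoefficients (phi C) (D.lDeltaTheta l) A)
  (hA : ∀ b : A, IsOpen (MulAction.stabilizer (Pi C) b : Set (Pi C)))
  (hfi : ∀ b : A, (MulAction.stabilizer (Pi C) b).FiniteIndex)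
  (O : Submonoid A) (ι₀ : Pi C)
  {Lbl : Type*} {P₀ : TopGroup.{0}} (φ₀ : P₀ →* D.GtpTheta) (s : Lbl → (P₀ →* Pi C))
  (hι : ∀ t, Continuous ((MonoidHom.id (Pi C)).comp (s t)))
  (hN : ∀ t, (⊤ : Subgroup P₀).map ((MonoidHom.id (Pi C)).comp (s t)) ≤ PiYdd C)
  (hφ : ∀ t, (phi C).comp ((MonoidHom.id (Pi C)).comp (s t)) = φ₀)
  [MulDistribMulAction P₀ A]
  (c₀ : CyclotomeCoefficients φ₀ (D.lDeltaTheta l) A)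
  (hA₀ : ∀ b : A, IsOpen (MulAction.stabilizer P₀ b : Set P₀))
  (hfi₀ : ∀ b : A, (MulAction.stabilizer P₀ b).FiniteIndex)

omit [(EtaleThetaDataOfSetting.PiYdd C).Normal] in
/-- Bookkeeping, PROVED (`rfl`): the Kummer map `κ = h1LimKummerOn c hA hfi O` of the genuine record, read through the
tautological identification `Additive (Multiplicative lim) ≃ lim`, IS abc-iut-w4-d007's `h1LimKummerOn` (hypothesis `hψκ` of
`restriction_kummerOn_eq_labelwise`). [cite: Mochizuki2012, Prop 3.1 (ii) p.88] -/
theorem additiveMultiplicative_h1LimKummerOn (m : O) :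
    AddEquiv.additiveMultiplicative (h1Lim (phi C) (D.lDeltaTheta l) (PiYdd C) ⊥)
        (Additive.ofMul (h1LimKummerOn (phi C) (D.lDeltaTheta l) (PiYdd C) c hA hfi O m)) =
      Multiplicative.toAdd (h1LimKummerOn (phi C) (D.lDeltaTheta l) (PiYdd C) c hA hfi O m) := rfl

/-- **(R) «restriction of constants» AT THE GENUINE RECORD** ([IUTchII] Cor 3.5 (i) p. 94 "by restricting the monoid
`Ψ_cns(M^Θ_*)` … via `Π_{v▶} ↠ G_v`"): along every evaluation section `s_t`, the restriction
`R_t = h1LimCongr ∘ s_t^*` of the Kummer class `κ m` of a constant `m ∈ O` is the `G_v`-level Kummer class `κ₀ m`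
(`κ₀ := h1LimKummerOn` over `G_v`) — for `G_v` acting on `A` as through the sections (`hact`). In the hypothesis shape
`hRκ` of abc-iut-w4-d004's iso clause. [cite: Mochizuki2012, Cor 3.5 (i) p.94] -/
theorem hRκ_thetaEnvRecordKummer (hc₀ : ∀ ζ, c₀.hom ζ = c.hom ζ)
    (hact : ∀ (t : Lbl) (g : P₀) (a : A), g • a = s t g • a)
    (R : Lbl → ((thetaEnvRecordKummer C hC hS hl hp2 hpl hζ mods f hf hmods h15 L hZ hcharY hlim c hA hfi O ι₀).H →*
      Multiplicative (h1Lim φ₀ (D.lDeltaTheta l) (⊤ : Subgroup P₀) ⊥)))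
    (hR : ∀ t y, Multiplicative.toAdd (R t y) =
      h1LimCongr (D.lDeltaTheta l) ⊤ (hφ t) ⊥
        (h1LimComap (phi C) (D.lDeltaTheta l) ((MonoidHom.id (Pi C)).comp (s t)) (hι t) (hN t)
          (AddEquiv.additiveMultiplicative (h1Lim (phi C) (D.lDeltaTheta l) (PiYdd C) ⊥) (Additive.ofMul y))))
    {i₀ : Pi C} (t : Lbl) (m : O)
    (hm : h1LimKummerOn (phi C) (D.lDeltaTheta l) (PiYdd C) c hA hfi O m ∈
      (thetaEnvRecordKummer C hC hS hl hp2 hpl hζ mods f hf hmods h15 L hZ hcharY hlim c hA hfi O ι₀).thetaMonoid i₀) :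
    ((R t).comp ((thetaEnvRecordKummer C hC hS hl hp2 hpl hζ mods f hf hmods h15 L hZ hcharY hlim c hA hfi O
        ι₀).thetaMonoid i₀).subtype) ⟨h1LimKummerOn (phi C) (D.lDeltaTheta l) (PiYdd C) c hA hfi O m, hm⟩ =
      h1LimKummerOn φ₀ (D.lDeltaTheta l) ⊤ c₀ hA₀ hfi₀ O m :=
  restriction_kummerOn_eq_labelwise'
    (thetaEnvRecordKummer C hC hS hl hp2 hpl hζ mods f hf hmods h15 L hZ hcharY hlim c hA hfi O ι₀)
    (phi C) φ₀ (D.lDeltaTheta l) (PiYdd C) c hA hfi c₀ hA₀ hfi₀ O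
    (h1LimKummerOn (phi C) (D.lDeltaTheta l) (PiYdd C) c hA hfi O) (MonoidHom.id (Pi C))
    (AddEquiv.additiveMultiplicative (h1Lim (phi C) (D.lDeltaTheta l) (PiYdd C) ⊥)) s hι hN hφ hc₀
    (fun t g a => hact t g a)
    (additiveMultiplicative_h1LimKummerOn C c hA hfi O) R hR t m hm

omit [MulDistribMulAction (Pi C) A] [TopologicalSpace A] [RootableBy A ℕ] in
/-- The constants module `A` being a (commutative) group, its submonoid `O` is cancellative — the hypothesis of
abc-iut-w4-d004's `uniqueFactorisation_of_not_isUnit`. [cite: Mochizuki2012, Prop 3.1 (ii) p.88] -/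
theorem isLeftCancelMul_submonoid : IsLeftCancelMul O :=
  ⟨fun _ _ _ h => Subtype.ext (mul_left_cancel (congrArg Subtype.val h))⟩

/-- **IUTchII:Cor3.5(ii)** (kurims p.95) "`Ψ^ι_env(M^Θ_*) ⥲ Ψ_ξ(M^Θ_*)` … isomorphisms of monoids" **AT THE GENUINE RECORD**
`thetaEnvRecordKummer` of the natural system `𝕄_*` of `X̲̲_K`: for `θ ∈ θ^{ι₀}_env(𝕄_*)`, label-wise continuous evaluation
sections `s_t` into `Π^tp_{Ÿ̲̲}` with common coefficient action `φ₀`, restrictions `R_t` pinned to `h1LimCongr ∘ s_t^*`, and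
`G_v` acting on the constants module as through the sections, THE UNIQUE ISOMORPHISM `Ψ^{ι₀}_env(𝕄_*) ⥲ Ψ_ξ ⊆ ∏_t κ₀(O)`,
`ξ = (κ₀ q_t)_t`, pinned to the restrictions — with the junction hypotheses (R) (restriction of constants), `hU`, `hUsurj`,
`hinj`, `hq₀` (unique factorisation) ALL DERIVED. Inputs beyond the data: (K) `κ`, `κ₀` injective; `horb`; (E) the theta
evaluation `R_t θ = κ₀ (q_t)` with `q_{t₀}` a non-unit of `O` (positive valuation). [cite: Mochizuki2012, Cor 3.5 (ii) p.95] -/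
theorem exists_unique_restrictionIso'_thetaEnvRecordKummer (hc₀ : ∀ ζ, c₀.hom ζ = c.hom ζ)
    (hact : ∀ (t : Lbl) (g : P₀) (a : A), g • a = s t g • a)
    (hκ : Function.Injective (h1LimKummerOn (phi C) (D.lDeltaTheta l) (PiYdd C) c hA hfi O))
    (hκ₀ : Function.Injective (h1LimKummerOn φ₀ (D.lDeltaTheta l) ⊤ c₀ hA₀ hfi₀ O))
    {i₀ : Pi C}
    {θ : (thetaEnvRecordKummer C hC hS hl hp2 hpl hζ mods f hf hmods h15 L hZ hcharY hlim c hA hfi O ι₀).H}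
    (hθ : θ ∈ (thetaEnvRecordKummer C hC hS hl hp2 hpl hζ mods f hf hmods h15 L hZ hcharY hlim c hA hfi O ι₀).thetaEnv i₀)
    (horb : ∀ θ' ∈ (thetaEnvRecordKummer C hC hS hl hp2 hpl hζ mods f hf hmods h15 L hZ hcharY hlim c hA hfi O
        ι₀).thetaEnv i₀,
      ∃ u ∈ (thetaEnvRecordKummer C hC hS hl hp2 hpl hζ mods f hf hmods h15 L hZ hcharY hlim c hA hfi O ι₀).units,
        θ' = u * θ)
    (R : Lbl → ((thetaEnvRecordKummer C hC hS hl hp2 hpl hζ mods f hf hmods h15 L hZ hcharY hlim c hA hfi O ι₀).H →*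
      Multiplicative (h1Lim φ₀ (D.lDeltaTheta l) (⊤ : Subgroup P₀) ⊥)))
    (hR : ∀ t y, Multiplicative.toAdd (R t y) =
      h1LimCongr (D.lDeltaTheta l) ⊤ (hφ t) ⊥
        (h1LimComap (phi C) (D.lDeltaTheta l) ((MonoidHom.id (Pi C)).comp (s t)) (hι t) (hN t)
          (AddEquiv.additiveMultiplicative (h1Lim (phi C) (D.lDeltaTheta l) (PiYdd C) ⊥) (Additive.ofMul y))))
    (q : Lbl → O)
    (hRθ : ∀ t, R t θ = h1LimKummerOn φ₀ (D.lDeltaTheta l) ⊤ c₀ hA₀ hfi₀ O (q t))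
    (t₀ : Lbl) (hq : ¬ IsUnit (q t₀)) :
    ∃! e : (thetaEnvRecordKummer C hC hS hl hp2 hpl hζ mods f hf hmods h15 L hZ hcharY hlim c hA hfi O ι₀).thetaMonoid i₀ ≃*
        gaussianMonoid (fun t =>
          ((R t).comp ((thetaEnvRecordKummer C hC hS hl hp2 hpl hζ mods f hf hmods h15 L hZ hcharY hlim c hA hfi O
              ι₀).thetaMonoid i₀).subtype).codRestrict
            (MonoidHom.mrange (h1LimKummerOn φ₀ (D.lDeltaTheta l) ⊤ c₀ hA₀ hfi₀ O))
            (restriction_mem_mrange_gen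
              (thetaEnvRecordKummer C hC hS hl hp2 hpl hζ mods f hf hmods h15 L hZ hcharY hlim c hA hfi O ι₀)
              (h1LimKummerOn (phi C) (D.lDeltaTheta l) (PiYdd C) c hA hfi O)
              (h1LimKummerOn φ₀ (D.lDeltaTheta l) ⊤ c₀ hA₀ hfi₀ O)
              (fun t => (R t).comp ((thetaEnvRecordKummer C hC hS hl hp2 hpl hζ mods f hf hmods h15 L hZ hcharY hlim c
                hA hfi O ι₀).thetaMonoid i₀).subtype)
              q hκ (ThetaEnvData.toRecord_constantMonoid _ _ _ _) hθ horb
              (fun t m hm => hRκ_thetaEnvRecordKummer C hC hS hl hp2 hpl hζ mods f hf hmods h15 L hZ hcharY hlim c hA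
                hfi O ι₀ φ₀ s hι hN hφ c₀ hA₀ hfi₀ hc₀ hact R hR t m hm)
              (fun t => hRθ t) t)
            ⟨θ, thetaEnv_subset_thetaMonoid
              (thetaEnvRecordKummer C hC hS hl hp2 hpl hζ mods f hf hmods h15 L hZ hcharY hlim c hA hfi O ι₀) i₀ hθ⟩),
      ∀ x, ((e x : gaussianMonoid _) : Lbl → MonoidHom.mrange (h1LimKummerOn φ₀ (D.lDeltaTheta l) ⊤ c₀ hA₀ hfi₀ O)) =
        MonoidHom.pi (fun t =>
          ((R t).comp ((thetaEnvRecordKummer C hC hS hl hp2 hpl hζ mods f hf hmods h15 L hZ hcharY hlim c hA hfi O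
              ι₀).thetaMonoid i₀).subtype).codRestrict
            (MonoidHom.mrange (h1LimKummerOn φ₀ (D.lDeltaTheta l) ⊤ c₀ hA₀ hfi₀ O))
            (restriction_mem_mrange_gen
              (thetaEnvRecordKummer C hC hS hl hp2 hpl hζ mods f hf hmods h15 L hZ hcharY hlim c hA hfi O ι₀)
              (h1LimKummerOn (phi C) (D.lDeltaTheta l) (PiYdd C) c hA hfi O)
              (h1LimKummerOn φ₀ (D.lDeltaTheta l) ⊤ c₀ hA₀ hfi₀ O)
              (fun t => (R t).comp ((thetaEnvRecordKummer C hC hS hl hp2 hpl hζ mods f hf hmods h15 L hZ hcharY hlim c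
                hA hfi O ι₀).thetaMonoid i₀).subtype)
              q hκ (ThetaEnvData.toRecord_constantMonoid _ _ _ _) hθ horb
              (fun t m hm => hRκ_thetaEnvRecordKummer C hC hS hl hp2 hpl hζ mods f hf hmods h15 L hZ hcharY hlim c hA
                hfi O ι₀ φ₀ s hι hN hφ c₀ hA₀ hfi₀ hc₀ hact R hR t m hm)
              (fun t => hRθ t) t)) x := by
  haveI : IsLeftCancelMul O := isLeftCancelMul_submonoid O
  exact exists_unique_restrictionIso'_ofKummer_gen_of_not_isUnit
    (thetaEnvRecordKummer C hC hS hl hp2 hpl hζ mods f hf hmods h15 L hZ hcharY hlim c hA hfi O ι₀)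
    (h1LimKummerOn (phi C) (D.lDeltaTheta l) (PiYdd C) c hA hfi O)
    (h1LimKummerOn φ₀ (D.lDeltaTheta l) ⊤ c₀ hA₀ hfi₀ O)
    (fun t => (R t).comp ((thetaEnvRecordKummer C hC hS hl hp2 hpl hζ mods f hf hmods h15 L hZ hcharY hlim c hA hfi O
      ι₀).thetaMonoid i₀).subtype)
    q hκ (ThetaEnvData.toRecord_constantMonoid _ _ _ _) hθ horb
    (fun t m hm => hRκ_thetaEnvRecordKummer C hC hS hl hp2 hpl hζ mods f hf hmods h15 L hZ hcharY hlim c hA hfi O ι₀ φ₀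
      s hι hN hφ c₀ hA₀ hfi₀ hc₀ hact R hR t m hm)
    (fun t => hRθ t) hκ₀ t₀ hq

/-- The restricted theta value in the labeled copy IS `κ₀ q_t` (the value-profile coordinate `ξ_t`), at the genuine record.
[cite: Mochizuki2012, Cor 3.5 (ii) p.94] -/
theorem restriction_theta_thetaEnvRecordKummer
    (R : Lbl → ((thetaEnvRecordKummer C hC hS hl hp2 hpl hζ mods f hf hmods h15 L hZ hcharY hlim c hA hfi O ι₀).H →*
      Multiplicative (h1Lim φ₀ (D.lDeltaTheta l) (⊤ : Subgroup P₀) ⊥)))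
    {i₀ : Pi C}
    {θ : (thetaEnvRecordKummer C hC hS hl hp2 hpl hζ mods f hf hmods h15 L hZ hcharY hlim c hA hfi O ι₀).H}
    (hθ : θ ∈ (thetaEnvRecordKummer C hC hS hl hp2 hpl hζ mods f hf hmods h15 L hZ hcharY hlim c hA hfi O ι₀).thetaEnv i₀)
    (q : Lbl → O) (hRθ : ∀ t, R t θ = h1LimKummerOn φ₀ (D.lDeltaTheta l) ⊤ c₀ hA₀ hfi₀ O (q t)) (t : Lbl) :
    ((R t).comp ((thetaEnvRecordKummer C hC hS hl hp2 hpl hζ mods f hf hmods h15 L hZ hcharY hlim c hA hfi O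
        ι₀).thetaMonoid i₀).subtype) ⟨θ, thetaEnv_subset_thetaMonoid
              (thetaEnvRecordKummer C hC hS hl hp2 hpl hζ mods f hf hmods h15 L hZ hcharY hlim c hA hfi O ι₀) i₀ hθ⟩ =
      h1LimKummerOn φ₀ (D.lDeltaTheta l) ⊤ c₀ hA₀ hfi₀ O (q t) :=
  hRθ t

end EtaleLevels

end Literature.IUT.HodgeArakelov

end
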